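import Summits.BirchSwinnertonDyer.Rank1Residual.Supersingular.SignedLambdaParityTwoMazurTate

/-!
# BlindFlatValueAN51 (= Sketch39; -an g35, MEMO-an §39) — the FLAT SHADOW at the quadratic character `ψ₂`

Setting: `E/ℚ` (newform `f` of level `N`), good SUPERSINGULAR reduction at `2` (`a₂ ∈ {0, ±2}`), Sprung's pair
`(L♯₂, L♭₂)` (`IsSprungPair f 2 a₂ L♯ L♭`: `θ_n ≡ −(u_n L♯ + v_n L♭) (mod ω_n)`, `u_n = sharpPoly a₂ 2 n`,
`v_n = flatPoly a₂ 2 n`).  The cyclotomic `ℤ₂`-extension has topological generator `γ = 5 ↔ 1+T`; its ORDER-2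
character `ψ₂` (field `ℚ(√2)`, Dirichlet character `χ₈`) is the point `T = ψ₂(γ) − 1 = −2`, the only `ι`-fixed
point `T ↦ (1+T)⁻¹ − 1` other than `T = 0`.

KERNEL FACT (proved below, `flatPoly_two_eval_neg_two`): `v_n(−2) = 0` for every `n ≥ 1` and every `a₂`
(`v_1 = 0`, `v_2 = −Φ_2(1+T) = −(T+2)`, recursion).  Hence every level clause is BLIND to `L♭₂(ψ₂)`:
`θ_n(ψ₂) = −u_n(−2)·L♯₂(ψ₂)` — the flat value at the quadratic character is NOT an interpolated `L`-value.

WHAT THE DATA AND SPRUNG'S COMPLETION SAY (MEMO-an §39; engine `cyc39.py` = Sprung's tandem/peeling algorithm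
[Sprung 2017 = arXiv:1211.1352, Prop. 3.3 / Cor. 3.6, non-completed] run EXACTLY on the D9 Mazur–Tate elements
`θ_0..θ_7` of all 2 603 good-supersingular curves `N < 12 000` (1 239 with `a₂ = 0`, 1 364 with `a₂ = ±2`); finite-level
pair `(S_n, B_n)` satisfies ALL tree clauses `m ≤ n` (checked 370/370), `S_n(−2) = −θ_1(−2)` exactly (3 801/3 801),
`B_n(−2) − B_{n−1}(−2) = −2·e_{n−1}(−2)·u_{n−1}(−2)` so `B_7(−2) ≡ L♭₂(ψ₂) (mod 2^{4+μ})` rigorously):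
* `c := w_E·χ₈(N) = −1` ⟹ `L♯₂(ψ₂) = 0` (interpolation + sign of `L(E⊗χ₈,s)`; 1 339/1 339) and `L♭₂(ψ₂) ≠ 0` certified
  (`v₂ ≤ 3+μ`) on 1 195 curves, undecided (`≡ 0 mod 2^{4+μ}`) on 144 — the `(p,n) = (2,1)` instance of the
  Kurihara–Pollack–Sprung gcd conjecture [arXiv:1211.1352 Conj. 6.14] (`FlatBlindNonvanishingAtTwo`, PRINT conjecture);
* `c = +1`, `a₂ = 0` ⟹ `L♭₂(ψ₂) = 0`: 607/607 (= tree theorem `subst_invOnePlusSubOne_eq_…_of_isSprungPair_two`, CONTROL);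
* `c = +1`, `a₂ = ±2` ⟹ `L♭₂(ψ₂) ≠ 0` (!) with `v₂(L♭₂(ψ₂)) = v₂(L♯₂(ψ₂)) + 1` and `L♭/L♯ ≡ −a₂ (mod 8)` on ALL 363
  curves where the precision decides (`v₂(L♯₂(ψ₂)) ≤ 2+μ`), 0 violations, 82 undecided.  THEORY (pole cancellation in
  Sprung's completion, `ana/kappa39.py`, stable to `2^24`): `L♭₂(E,ψ₂) = −(a₂/5)·L♯₂(E,ψ₂)` — ONE law for all even `a₂`
  (`a₂ = 0` gives the forced zero).  This is `FlatShadowAtTwo` below (the §39 TYPED CANDIDATE; not in print).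
ERRATUM CANDIDATE (X-an-39c, for REF2): the same computation shows Sprung's COMPLETED `L̂♭₂` has a simple POLE at `ψ₂`
with residue `2a₂·L̂♯₂(ψ₂) ≠ 0` whenever `L(E,χ₈,1) ≠ 0` (`a₂ = ±2`), i.e. [arXiv:1211.1352 Cor. 3.12] «their completions
are in Λ» fails at `(p, a_p) = (2, ±2)` (consistent with the cell's X-an-37c).
-/

namespace Summit.BirchSwinnertonDyer.Cruxes.RankOneAtTwoBigImageOddLocal.BlindFlatAN51

open Polynomial CongruenceSubgroup WeierstrassCurve Literature.NumberTheory.EllipticCurves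
open Literature.NumberTheory.EllipticCurves.ModularForms Literature.NumberTheory.EllipticCurves.Sprung2017
open scoped MatrixGroups ModularForm

/-! ## §1. Kernel facts: the flat chromatic polynomials vanish at `T = −2` (`p = 2`, every `a₂`) -/

/-- `Φ_{2^{n+2}}(1+T)` at `T = −2` is `Φ_{2^{n+2}}(−1) = 1 + (−1)^{2^{n+1}} = 2`. [folklore] -/
theorem cyclotomic_two_pow_comp_eval_neg_two (n : ℕ) :
    ((cyclotomic (2 ^ (n + 2)) ℤ).comp (X + 1)).eval (-2 : ℤ) = 2 := by
  rw [eval_comp, eval_add, eval_X, eval_one, show (-2 : ℤ) + 1 = -1 by norm_num,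
    show n + 2 = (n + 1) + 1 from rfl, cyclotomic_prime_pow_eq_geom_sum Nat.prime_two, eval_finsetSum]
  simp only [Finset.sum_range_succ, Finset.sum_range_zero, eval_pow, eval_X, zero_add, pow_zero]
  rw [pow_succ' 2 n, pow_mul]
  norm_num

/-- `Φ_2(1+T) = T + 2` vanishes at `T = −2`. [folklore] -/
theorem cyclotomic_two_comp_eval_neg_two :
    ((cyclotomic (2 ^ (0 + 1)) ℤ).comp (X + 1)).eval (-2 : ℤ) = 0 := by
  rw [zero_add, pow_one, cyclotomic_two, eval_comp, eval_add, eval_X, eval_one, eval_add, eval_X, eval_one]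
  norm_num

/-- Two consecutive flat polynomials vanish at `−2` (induction carrier). -/
theorem flatPoly_two_eval_neg_two_aux (a : ℤ) : ∀ n : ℕ,
    (flatPoly a 2 (n + 1)).eval (-2 : ℤ) = 0 ∧ (flatPoly a 2 (n + 2)).eval (-2 : ℤ) = 0
  | 0 => by
      refine ⟨by simp [flatPoly_one], ?_⟩
      rw [flatPoly_two, eval_neg, cyclotomic_two_comp_eval_neg_two, neg_zero]
  | n + 1 => by
      obtain ⟨h1, h2⟩ := flatPoly_two_eval_neg_two_aux a n
      refine ⟨h2, ?_⟩
      rw [show n + 1 + 2 = (n + 1) + 2 from rfl, flatPoly_add_two, eval_sub, eval_mul, eval_mul, eval_C,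
        show n + 1 + 1 = n + 2 from rfl, h2, h1, mul_zero, mul_zero, sub_zero]

/-- **`v_n(ψ₂) = 0`**: `(flatPoly a 2 n)(−2) = 0` for all `n ≥ 1`, every trace `a`. The level clauses of
`IsSprungPair f 2 a` are blind to the value of `L♭₂` at the quadratic character. -/
theorem flatPoly_two_eval_neg_two (a : ℤ) {n : ℕ} (hn : 1 ≤ n) : (flatPoly a 2 n).eval (-2 : ℤ) = 0 := by
  obtain ⟨m, rfl⟩ := Nat.exists_eq_add_of_le hn
  rw [add_comm]
  exact (flatPoly_two_eval_neg_two_aux a m).1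

/-- Divisibility form: `(T + 2) ∣ v_n` in `ℤ[T]` for `n ≥ 1`. -/
theorem X_add_two_dvd_flatPoly_two (a : ℤ) {n : ℕ} (hn : 1 ≤ n) : (X + C 2 : ℤ[X]) ∣ flatPoly a 2 n := by
  have h : (X - C (-2 : ℤ)) ∣ flatPoly a 2 n := dvd_iff_isRoot.mpr (flatPoly_two_eval_neg_two a hn)
  simpa [map_neg, sub_neg_eq_add] using h

/-- … and in `Λ = ℤ₂⟦T⟧` under `toIwasawa 2`. -/
theorem toIwasawa_X_add_two_dvd_flatPoly (a : ℤ) {n : ℕ} (hn : 1 ≤ n) :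
    toIwasawa 2 (X + C 2) ∣ toIwasawa 2 (flatPoly a 2 n) :=
  map_dvd (toIwasawa 2) (X_add_two_dvd_flatPoly_two a hn)

/-- The sharp values at `ψ₂` obey `u_{n+3}(−2) = a·u_{n+2}(−2) − 2·u_{n+1}(−2)` (so `|u_n(−2)|₂ → 0` like
`2^{−n/2}` for `a = ±2`, `u_{2k}(−2) = 0` for `a = 0`): the source of the `(T+2)`-adic precision model
`B_n(−2) − B_{n−1}(−2) = −2 e_{n−1}(−2) u_{n−1}(−2)` of the census. -/
theorem sharpPoly_two_eval_neg_two_rec (a : ℤ) (n : ℕ) :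
    (sharpPoly a 2 (n + 3)).eval (-2 : ℤ) =
      a * (sharpPoly a 2 (n + 2)).eval (-2) - 2 * (sharpPoly a 2 (n + 1)).eval (-2) := by
  rw [show n + 3 = (n + 1) + 2 from rfl, sharpPoly_add_two, eval_sub, eval_mul, eval_mul, eval_C,
    show n + 1 + 1 = n + 2 from rfl, cyclotomic_two_pow_comp_eval_neg_two]

/-! ## §2. Values at `ψ₂` and the typed statements -/

/-- `F(ψ₂) = c`: the power series `F ∈ ℤ₂⟦T⟧` takes the value `c` at `T = −2`, stated by Weierstrass division by the
distinguished polynomial `T + 2` (no analytic evaluation needed): `(T + 2) ∣ F − c`. [folklore] -/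
def HasValueAtNegTwo (F : IwasawaAlgebra 2) (c : ℤ_[2]) : Prop :=
  toIwasawa 2 (X + C 2) ∣ F - PowerSeries.C c

/-- **TYPED CANDIDATE (P-an-39κ) `FlatShadowAtTwo` — the flat shadow constant `−a₂/5`.**
For `E/ℚ` with good supersingular reduction at `2` (`2 ∣ a₂`, so `a₂ ∈ {0, ±2}`) and `w_E·χ₈(N) = +1`:
`5 · L♭₂(E, ψ₂) = −a₂ · L♯₂(E, ψ₂)` in `ℤ₂`.
* `a₂ = 0`: the forced flat zero `L♭₂(ψ₂) = 0` — the tree's functional-equation theorem (CONTROL, 607/607).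
* `a₂ = ±2`: NEW — `L♭₂(ψ₂)` is a nonzero shadow of `L♯₂(ψ₂) ∝ L(E,χ₈,1)/Ω`; census: `v₂(B_7(−2)) = v₂(S_7(−2)) + 1` and
  `B/S ≡ −a₂ (mod 8)` on 363/363 decided curves (172 at `v₂(S) = 1+μ` fix `κ mod 8`, 191 at `v₂(S) = 2+μ` fix `κ mod 4`),
  0 violations, 82 undecided (`v₂(S) ≥ 3+μ`); both congruences are what `κ = −a₂/5` predicts (`−2/5 ≡ 6`, `2/5 ≡ 2 mod 8`).
* Derivation (not a proof): `(L♯,L♭) = (L̂♯,L̂♭)·R`, `R = L̂og·Log⁻¹ = 𝒞_1 Q 𝒞_1⁻¹`, `Q = lim 𝒞̂_2⋯𝒞̂_n(𝒞_2⋯𝒞_n)⁻¹`,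
  `Q(−2) = diag(1,−1)`, `Res_{−2} R_{12} = −2a₂`; analyticity of `L♭` + the scalar functional equations of `L̂♯`, `L̂♭`
  [arXiv:1211.1352 Prop. 2.23 + MTT] give `κ = −(ρ'(0) + 2a₂R₂₂'(0)) = −a₂/5` (2-adically stable to `2^24`, `n ≤ 28`).
Cheapest falsifier: ONE curve with `a₂ = ±2`, `w·χ₈(N) = +1`, `v₂(S_7(−2)) = 1+μ` and `(B_7/S_7)(−2)/2 ≢ −a₂/10 (mod 4)` —
run: 0 of 172.  Sharper (needs `θ_8`, data ask D-an-39): `κ/2 ≡ 3 (a₂ = 2) resp. 5 (a₂ = −2) (mod 8)`. -/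
def FlatShadowAtTwo : Prop :=
  ∀ (N : ℕ) [NeZero N] (f : CuspForm (Gamma0 N) 2) (W : WeierstrassCurve ℚ) [W.IsElliptic] [W.IsGloballyMinimal],
    IsNewformOf W f → W.HasGoodReductionAtPrime 2 → (2 : ℤ) ∣ W.frobeniusTrace 2 →
    (W.rootNumber : ℤ) * ZMod.χ₈ (N : ZMod 8) = 1 →
  ∀ (Lsharp Lflat : IwasawaAlgebra 2), IsSprungPair f 2 (W.frobeniusTrace 2) Lsharp Lflat →
  ∀ (s b : ℤ_[2]), HasValueAtNegTwo Lsharp s → HasValueAtNegTwo Lflat b →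
    (5 : ℤ_[2]) * b = -((W.frobeniusTrace 2 : ℤ) : ℤ_[2]) * s

/-- **(P-an-39♭) `FlatBlindNonvanishingAtTwo`** — the `(p,n) = (2,1)` instance of the Kurihara–Pollack–Sprung gcd
conjecture [arXiv:1211.1352 Conj. 6.14; Prop. 6.10 proves only «exponent `d_1 − 1` or `d_1`»]: for good supersingular `2`
and `w_E·χ₈(N) = −1` (so `L♯₂(ψ₂) = 0`), if the sharp zero at `ψ₂` is simple then the BLIND flat value is nonzero.
Census (`B_7(−2) mod 2^{4+μ}`): certified nonzero on 1 195 of 1 339 curves (`a₂ = 0`: 562/632; `a₂ = ±2`: 633/707),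
undecided 144 (no simplicity filter applied; undecided rows are candidates for `ord_{s=1} L(E⊗χ₈,s) ≥ 3`). PRINT conjecture. -/
def FlatBlindNonvanishingAtTwo : Prop :=
  ∀ (N : ℕ) [NeZero N] (f : CuspForm (Gamma0 N) 2) (W : WeierstrassCurve ℚ) [W.IsElliptic] [W.IsGloballyMinimal],
    IsNewformOf W f → W.HasGoodReductionAtPrime 2 → (2 : ℤ) ∣ W.frobeniusTrace 2 →
    (W.rootNumber : ℤ) * ZMod.χ₈ (N : ZMod 8) = -1 →
  ∀ (Lsharp Lflat : IwasawaAlgebra 2), IsSprungPair f 2 (W.frobeniusTrace 2) Lsharp Lflat →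
    ¬ toIwasawa 2 (X + C 2) ^ 2 ∣ Lsharp → ¬ toIwasawa 2 (X + C 2) ∣ Lflat

/-- **(P-an-39♯) `SharpForcedZeroAtTwo`** (CONTROL, corollary of print): `w_E·χ₈(N) = −1` ⟹ `L♯₂(E,ψ₂) = 0`
(`θ_1 ≡ −L♯ (mod ω_1)` and `θ_1(ψ₂) ∝ L(E,χ₈,1) = 0` since `w(E⊗χ₈) = w_E·χ₈(−N) = w_E·χ₈(N) = −1`).
Census: `S_7(−2) = −θ_1(−2) = 0` on 1 339/1 339. [Sprung 2017 (1.2) + MTT interpolation; nothing new] -/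
def SharpForcedZeroAtTwo : Prop :=
  ∀ (N : ℕ) [NeZero N] (f : CuspForm (Gamma0 N) 2) (W : WeierstrassCurve ℚ) [W.IsElliptic] [W.IsGloballyMinimal],
    IsNewformOf W f → W.HasGoodReductionAtPrime 2 → (2 : ℤ) ∣ W.frobeniusTrace 2 →
    (W.rootNumber : ℤ) * ZMod.χ₈ (N : ZMod 8) = -1 →
  ∀ (Lsharp Lflat : IwasawaAlgebra 2), IsSprungPair f 2 (W.frobeniusTrace 2) Lsharp Lflat →
    toIwasawa 2 (X + C 2) ∣ Lsharp

end Summit.BirchSwinnertonDyer.Cruxes.RankOneAtTwoBigImageOddLocal.BlindFlatAN51
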